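import Mathlib
import Summits.Ventures.PercRepro2.Defs
import Summits.Ventures.PercRepro2.Harris
import Summits.Ventures.PercRepro2.CoinDefs
import Summits.Ventures.PercRepro2.CoinReverse
import Summits.Ventures.PercRepro2.CoinStarDefs
import Summits.Ventures.PercRepro2.CoinLsmCoreDefs
import Summits.Ventures.PercRepro2.CoinLsmCoreU

/-!
# The cleared gate functional of a closed-in core as core sums (blind cell PercRepro2, night-2
g8; proofs/NIGHT2-DARC.md §32.3)

`ClosedInCoreU.phiC_gate_eq`: over a closed-in core `C` (pairs at the root allowed), the cleared
functional `P(R)²·E[XY; gate] − P(R)·E[X; R]·E[Y; gate] − P(R)·E[Y; R]·E[X; gate] + E[X; R]·E[Y; R]·P(gate)`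
of the arc `u → w` is the polynomial in the core sums `Σ_W ν(W)·A(W)·(…)` (the `R`-moments) and
`Σ_W ν(W)·A(starTarget u w W)·(…)` (the gate moments), `ν(W) = P(level W)`,
`A(X) = P(X ∪ {s} ↛ t without the core coins)`, `starTarget u w W = W ∪ {w}` if `u ∈ W` else `W`.
This is the bookkeeping half of g7's `darc_of_uCellLsmU` isolated, for proofs that certify the
whole functional at once (the directed diamond, `CoinDiamondCore.lean`).
-/

namespace Summit.Ventures.PercRepro2.Coin

open Classical

section CoreGate

variable {V : Type*} {E : Type*} [Fintype V] [DecidableEq V] [Fintype E] [DecidableEq E]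
  {R : Type*} [Field R] [LinearOrder R] [IsStrictOrderedRing R]
  {arcs : E → Finset (V × V)} {s : V} {C : Finset V}

omit [Fintype V] [LinearOrder R] [IsStrictOrderedRing R] in
/-- The cleared gate functional as core sums. -/
theorem ClosedInCoreU.phiC_gate_eq (h : ClosedInCoreU arcs s C) (p : E → R) (hS : SameEnds arcs)
    {t : V} (htC : t ∉ C) (hts : t ≠ s) {a b u w : V} (ha : a ∈ C) (hb : b ∈ C) (hu : u ∈ C)
    (hws : w ≠ s) (hwC : w ∉ C) :
    phiC p arcs s {t} a b (gateEvent arcs s {t} u w) =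
      (∑ W ∈ C.powerset, prob p (coreLevel arcs s C W) * prob p (coreAvoidEvent arcs s t C W)) ^ 2 *
          (∑ W ∈ C.powerset, prob p (coreLevel arcs s C W) *
            prob p (coreAvoidEvent arcs s t C (starTarget u w W)) *
            ((if a ∈ W then (1 : R) else 0) * (if b ∈ W then (1 : R) else 0)))
        - (∑ W ∈ C.powerset, prob p (coreLevel arcs s C W) * prob p (coreAvoidEvent arcs s t C W)) *
          (∑ W ∈ C.powerset, prob p (coreLevel arcs s C W) * prob p (coreAvoidEvent arcs s t C W) *
            (if a ∈ W then (1 : R) else 0)) *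
          (∑ W ∈ C.powerset, prob p (coreLevel arcs s C W) *
            prob p (coreAvoidEvent arcs s t C (starTarget u w W)) * (if b ∈ W then (1 : R) else 0))
        - (∑ W ∈ C.powerset, prob p (coreLevel arcs s C W) * prob p (coreAvoidEvent arcs s t C W)) *
          (∑ W ∈ C.powerset, prob p (coreLevel arcs s C W) * prob p (coreAvoidEvent arcs s t C W) *
            (if b ∈ W then (1 : R) else 0)) *
          (∑ W ∈ C.powerset, prob p (coreLevel arcs s C W) *
            prob p (coreAvoidEvent arcs s t C (starTarget u w W)) * (if a ∈ W then (1 : R) else 0))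
        + (∑ W ∈ C.powerset, prob p (coreLevel arcs s C W) * prob p (coreAvoidEvent arcs s t C W) *
            (if a ∈ W then (1 : R) else 0)) *
          (∑ W ∈ C.powerset, prob p (coreLevel arcs s C W) * prob p (coreAvoidEvent arcs s t C W) *
            (if b ∈ W then (1 : R) else 0)) *
          (∑ W ∈ C.powerset, prob p (coreLevel arcs s C W) *
            prob p (coreAvoidEvent arcs s t C (starTarget u w W))) := by
  set ν : Finset V → R := fun W => prob p (coreLevel arcs s C W) with hνdef
  set A : Finset V → R := fun X => prob p (coreAvoidEvent arcs s t C X) with hA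
  set x : Finset V → R := fun W => if a ∈ W then 1 else 0 with hx
  set y : Finset V → R := fun W => if b ∈ W then 1 else 0 with hy
  set X : Config E → R := marker (R := R) arcs s a with hX
  set Y : Config E → R := marker (R := R) arcs s b with hY
  have hxc : ∀ W ⊆ C, ∀ ω ∈ coreLevel arcs s C W, X ω = x W :=
    fun W _ ω hω => marker_on_coreLevel ha hω
  have hyc : ∀ W ⊆ C, ∀ ω ∈ coreLevel arcs s C W, Y ω = y W :=
    fun W _ ω hω => marker_on_coreLevel hb hω
  have hxyc : ∀ W ⊆ C, ∀ ω ∈ coreLevel arcs s C W, (fun ω => X ω * Y ω) ω = x W * y W :=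
    fun W hW ω hω => by simp only [hxc W hW ω hω, hyc W hW ω hω]
  have h1c : ∀ W ⊆ C, ∀ ω ∈ coreLevel arcs s C W,
      (fun _ : Config E => (1 : R)) ω = (fun _ => (1 : R)) W := fun _ _ _ _ => rfl
  have hR := h.avoid_eq_biUnion hS htC hts
  have hG := h.gate_eq_biUnion hS htC hts hu hwC hws
  have hPR : prob p (avoidEvent arcs s {t}) = ∑ W ∈ C.powerset, ν W * A W := by
    rw [prob_eq_massE_one, hR, h.core_mass p t (fun W => W) h1c]
    simp only [one_mul]
    rfl
  have hXR : massE p X (avoidEvent arcs s {t}) = ∑ W ∈ C.powerset, ν W * A W * x W := by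
    rw [hR, h.core_mass p t (fun W => W) hxc]
    exact Finset.sum_congr rfl fun W _ => by ring
  have hYR : massE p Y (avoidEvent arcs s {t}) = ∑ W ∈ C.powerset, ν W * A W * y W := by
    rw [hR, h.core_mass p t (fun W => W) hyc]
    exact Finset.sum_congr rfl fun W _ => by ring
  have hPG : prob p (gateEvent arcs s {t} u w) =
      ∑ W ∈ C.powerset, ν W * A (starTarget u w W) := by
    rw [prob_eq_massE_one, hG, h.core_mass p t (starTarget u w) h1c]
    simp only [one_mul]
    rfl
  have hXG : massE p X (gateEvent arcs s {t} u w) =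
      ∑ W ∈ C.powerset, ν W * A (starTarget u w W) * x W := by
    rw [hG, h.core_mass p t (starTarget u w) hxc]
    exact Finset.sum_congr rfl fun W _ => by ring
  have hYG : massE p Y (gateEvent arcs s {t} u w) =
      ∑ W ∈ C.powerset, ν W * A (starTarget u w W) * y W := by
    rw [hG, h.core_mass p t (starTarget u w) hyc]
    exact Finset.sum_congr rfl fun W _ => by ring
  have hXYG : massE p (fun ω => X ω * Y ω) (gateEvent arcs s {t} u w) =
      ∑ W ∈ C.powerset, ν W * A (starTarget u w W) * (x W * y W) := by
    rw [hG, h.core_mass p t (starTarget u w) hxyc]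
    exact Finset.sum_congr rfl fun W _ => by ring
  unfold phiC
  simp only
  rw [hPR, hXR, hYR, hPG, hXG, hYG, hXYG]

end CoreGate

end Summit.Ventures.PercRepro2.Coin
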